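import Literature.Barriers.Parity.SiegelZeroQuadraticPolynomialsProp2Limit
import Literature.Barriers.Parity.SiegelZeroQuadraticPolynomialsInputsProofs
import Literature.NumberTheory.LFunctions.SmoothEulerProductSandwich
import Literature.NumberTheory.LFunctions.EulerProductAtOne
import Literature.NumberTheory.LFunctions.ExceptionalZeroLogDerivOne
import Literature.NumberTheory.LFunctions.SiegelZeroExceptionalPrimesSecond
import HarnessLib

/-!
# Granville–Mollin's Proposition 2, discharged by the elementary (sieve-free, zero-free) route

Topic `Literature/Barriers/Parity`, companion of the catalogue entry
`SiegelZeroQuadraticPolynomials.lean` (Granville–Mollin, *Rabinowitsch revisited*, Acta Arith. 96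
(2000)). Everything here is PROVED; no definition is introduced. Main result:

* `GranvilleMollin2000_prop2_holds : GranvilleMollin2000_prop2` — **Proposition 2** ("Suppose that
  there is a Siegel zero for `L(s, (d/·))` with `η → ∞` as `|d| → ∞`. Then `ϱ_d ∼ c_f/log(|d|^η)`"),
  DISCHARGED.

The printed proof (§8) evaluates `c_f/ϱ_d = ∏_{p ≤ √d}(1 − 1/p)⁻¹ ∏_{p > √d}(1 − ω(p)/p)(1 − 1/p)⁻¹`
with Mertens' theorem, (5.7) and the Linnik-range explicit formula (3.3) (the tree's conditional
`GranvilleMollin2000_prop2_of_eq33_of_prop35`). Here (3.3) is replaced by the positivity method of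
Tao–Teräväinen (*The Hardy–Littlewood–Chowla conjecture in the presence of a Siegel zero*, J. London
Math. Soc. 106 (2022), §3.3), all of whose ingredients are theorems of this tree. With `q = |d|`,
`χ = (·/q)` the primitive quadratic character mod `q`, `ω(p) = 1 + χ(p)`, `L = log q`,
`s₀ = ⌊√q⌋`, `π_p = (1 − 1/p)⁻¹(1 − χ(p)/p)⁻¹`, `P₀ = ∏_{p ≤ s₀} π_p`,
`G(N) = ∑_{n ≤ N} (1∗χ)(n)/n`, `F(X) = ∑_{p ≤ X} −log(1 − χ(p)/p)` and `T = ηL · L(1, χ)`: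

1. (algebra) for `X ≥ s₀` the Bateman–Horn partial product `B(X) = ∏_{p ≤ X}(1 − 1/p)⁻¹(1 − ω(p)/p)`
   satisfies `log B(X) = log P₀ + log ϱ_d − F(X) + ∑_{s₀ < p ≤ X} log κ_p`,
   `κ_p = π_p (1 − ω(p)/p) = 1 − χ(p)/((p−1)(p−χ(p)))`, `|log κ_p| ≤ 8/p²`
   (`abs_log_kappa_le`, `abs_sum_log_kappa_le`);
2. `F(X) → log L(1, χ)` with a rate (the tree's `EulerProductOne.abs_log_sub_sum_le`, from Mertens'
   estimate for `∑ χ(p) log p/p`);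
3. **main lemma** `|log P₀ − log T| = o(1)`: by Montgomery–Vaughan's mean value and the `L'/L(1, χ)`
   comparison at the exceptional zero (the tree's `SiegelZero.exists_abs_harmSum_sub_le`,
   `ExceptionalZero.exists_abs_sub_le_div_eta`), `G(N) = T(1 + O((u + O(1))/η))` at `N = ⌈q^u⌉`;
   Rankin's trick (`SmoothEulerProduct.smoothProduct_le_sum_add_exp`) gives
   `P₀ ≤ G(N) + e^{24−u} P₀`, and the smooth-number majorant (`SmoothEulerProduct.sum_le_smoothProduct`)
   gives `G(N) ≤ P₀ ∏_{s₀ < p ≤ N} π_p ≤ P₀ exp(4 ∑_{s₀ < p* ≤ N} 1/p* + 4/(s₀+1))`, the exceptional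
   primes `p*` (`χ(p*) ≠ −1`) being sparse by Tao–Teräväinen's Proposition 3.5
   (`TaoTeravainen2021_eq313_holds`, `TaoTeravainen2021_eq314_holds`): `≪ η^{−1/2} + u/η`;
4. letting `X → ∞` along the convergent partial products (`pos_and_abs_log_sub_le_of_tendsto`,
   `abs_sub_le_mul_of_abs_log_sub_le` of `…Prop2Limit.lean`) gives `c_f > 0` and
   `|ϱ_d − c_f/(ηL)| ≤ ε c_f/(ηL)` once `u`, then `η₀(ε)`, then `d₀(ε)` are chosen.

No Mertens asymptotics with `e^γ` are needed: the factors `∏_{p ≤ X}(1 − 1/p)⁻¹` cancel exactly.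
For `d ≡ 1 (mod 8)` (`ω(2) = 2`) the partial products vanish, `c_f = 0 = ϱ_d`, as in the source.

## References

* A. Granville, R. A. Mollin, *Rabinowitsch revisited*, Acta Arith. 96 (2000), 139–153,
  Proposition 2 and §8. [GranvilleMollin2000]
* T. Tao, J. Teräväinen, *The Hardy–Littlewood–Chowla conjecture in the presence of a Siegel
  zero*, J. London Math. Soc. (2) 106 (2022), §3.3, Proposition 3.5. [TaoTeravainen2021]
* H. L. Montgomery, R. C. Vaughan, *Multiplicative Number Theory I*, CUP 2007, §4.3, §11.2.
  [MontgomeryVaughan2007]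
-/

noncomputable section

open Finset Real Filter
open scoped Topology
open Literature.NumberTheory.Sieve Literature.NumberTheory.LFunctions
open Literature.NumberTheory.LFunctions.SiegelZero Literature.NumberTheory.LFunctions.DirichletAbel

namespace Literature.Barriers.Parity

/-! ### Elementary logarithmic inequalities -/

/-- `|log(1 − u)| ≤ 2u` for `0 ≤ u ≤ 1/2`. [folklore] -/
theorem abs_log_one_sub_le {u : ℝ} (hu0 : 0 ≤ u) (hu1 : u ≤ 1 / 2) : |Real.log (1 - u)| ≤ 2 * u := by
  have h := Literature.NumberTheory.Sieve.abs_log_one_sub_add_le hu0 hu1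
  have h1 : |Real.log (1 - u)| ≤ |Real.log (1 - u) + u| + |u| := by
    have := abs_sub (Real.log (1 - u) + u) u
    simpa using this
  rw [abs_of_nonneg hu0] at h1
  nlinarith

/-- `log(1 + x) ≤ x` for `x ≥ 0`, and it is `≥ 0`. [folklore] -/
theorem log_one_add_le_self {x : ℝ} (hx : 0 ≤ x) : 0 ≤ Real.log (1 + x) ∧ Real.log (1 + x) ≤ x := by
  refine ⟨Real.log_nonneg (by linarith), ?_⟩
  have := Real.log_le_sub_one_of_pos (show (0 : ℝ) < 1 + x by linarith)
  linarith

/-- **`|log κ_p| ≤ 8/p²`**: for `c ∈ {0, 1, −1}` and `p ≥ 3`,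
`|log(1 − (1+c)/p) − log(1 − 1/p) − log(1 − c/p)| ≤ 8/p²`
(`κ_p = (1 − (1+c)/p)/((1 − 1/p)(1 − c/p)) = 1 − c/((p−1)(p−c))`). [folklore] -/
theorem abs_log_kappa_le {c p : ℝ} (hc : c = 0 ∨ c = 1 ∨ c = -1) (hp : 3 ≤ p) :
    |Real.log (1 - (1 + c) / p) - Real.log (1 - 1 / p) - Real.log (1 - c / p)| ≤ 8 / p ^ 2 := by
  have hp0 : 0 < p := by linarith
  have hp2 : 0 < p ^ 2 := by positivity
  rcases hc with rfl | rfl | rfl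
  · -- `c = 0`: `κ = 1`
    have : Real.log (1 - (1 + 0) / p) - Real.log (1 - 1 / p) - Real.log (1 - 0 / p) = 0 := by
      simp
    rw [this, abs_zero]; positivity
  · -- `c = 1`: `1 − 2/p = (1 − 1/p)² (1 − t)`, `t = 1/(p−1)²`
    set t : ℝ := 1 / (p - 1) ^ 2 with ht
    have hp1 : 0 < p - 1 := by linarith
    have ht0 : 0 ≤ t := by positivity
    have ht4 : t ≤ 1 / 4 := by
      rw [ht, div_le_div_iff₀ (by positivity) (by norm_num)]; nlinarith
    have hfac : 1 - (1 + 1) / p = (1 - 1 / p) ^ 2 * (1 - t) := by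
      rw [ht]; field_simp; ring
    have h1p : 0 < 1 - 1 / p := by rw [sub_pos, div_lt_one hp0]; linarith
    have h1t : 0 < 1 - t := by linarith
    rw [hfac, Real.log_mul (pow_pos h1p 2).ne' h1t.ne', Real.log_pow]
    have : ((2 : ℕ) : ℝ) * Real.log (1 - 1 / p) + Real.log (1 - t) - Real.log (1 - 1 / p) -
        Real.log (1 - 1 / p) = Real.log (1 - t) := by push_cast; ring
    rw [this]
    calc |Real.log (1 - t)| ≤ 2 * t := abs_log_one_sub_le ht0 (by linarith)
      _ ≤ 8 / p ^ 2 := by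
          rw [ht, mul_one_div, div_le_div_iff₀ (by positivity) hp2]; nlinarith
  · -- `c = −1`: `κ = (1 − 1/p²)⁻¹`
    have h1 : 1 - (1 + -1) / p = 1 := by ring
    have hfac : (1 - 1 / p) * (1 - -1 / p) = 1 - 1 / p ^ 2 := by field_simp; ring
    have h1p : 0 < 1 - 1 / p := by rw [sub_pos, div_lt_one hp0]; linarith
    have h1p' : 0 < 1 - -1 / p := by
      have : 0 < 1 / p := by positivity
      linarith [show -1 / p = -(1 / p) by ring]
    have hu0 : (0 : ℝ) ≤ 1 / p ^ 2 := by positivity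
    have hu1 : 1 / p ^ 2 ≤ 1 / 2 := by
      rw [div_le_div_iff₀ hp2 (by norm_num)]; nlinarith
    rw [h1, Real.log_one, show (0 : ℝ) - Real.log (1 - 1 / p) - Real.log (1 - -1 / p) =
      -(Real.log (1 - 1 / p) + Real.log (1 - -1 / p)) by ring, ← Real.log_mul h1p.ne' h1p'.ne', hfac,
      abs_neg]
    calc |Real.log (1 - 1 / p ^ 2)| ≤ 2 * (1 / p ^ 2) := abs_log_one_sub_le hu0 hu1
      _ ≤ 8 / p ^ 2 := by rw [mul_one_div, div_le_div_iff₀ hp2 hp2]; nlinarith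

/-- **The local Euler factors are almost `1` away from the exceptional primes**: for `c ∈ {0, 1, −1}`
and `p ≥ 2`, `π_p = (1 − 1/p)⁻¹(1 − c/p)⁻¹ > 0` and
`log π_p ≤ 2/p² + (4/p if c ≠ −1, else 0)`. [folklore] -/
theorem log_eulerFactor_le {c p : ℝ} (hc : c = 0 ∨ c = 1 ∨ c = -1) (hp : 2 ≤ p) :
    0 < (1 - p⁻¹)⁻¹ * (1 - c * p⁻¹)⁻¹ ∧
      Real.log ((1 - p⁻¹)⁻¹ * (1 - c * p⁻¹)⁻¹) ≤ 2 / p ^ 2 + (if c = -1 then 0 else 4 / p) := by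
  have hp0 : 0 < p := by linarith
  have hp2 : 0 < p ^ 2 := by positivity
  have hinv : p⁻¹ ≤ 1 / 2 := by rw [inv_eq_one_div, div_le_div_iff₀ hp0 (by norm_num)]; linarith
  have hinv0 : 0 < p⁻¹ := inv_pos.mpr hp0
  have h1p : 0 < 1 - p⁻¹ := by linarith
  have hlog1 : -Real.log (1 - p⁻¹) ≤ 2 * p⁻¹ := by
    have := abs_log_one_sub_le hinv0.le hinv
    have := (abs_le.mp this).1
    linarith
  rcases hc with rfl | rfl | rfl
  · -- `c = 0`
    simp only [zero_mul, sub_zero, inv_one, mul_one]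
    refine ⟨inv_pos.mpr h1p, ?_⟩
    rw [if_neg (by norm_num), Real.log_inv]
    have : 2 * p⁻¹ ≤ 2 / p ^ 2 + 4 / p := by
      rw [inv_eq_one_div]
      have : 0 ≤ 2 / p ^ 2 := by positivity
      have : 2 * (1 / p) ≤ 4 / p := by rw [mul_one_div, div_le_div_iff₀ hp0 hp0]; nlinarith
      linarith
    linarith
  · -- `c = 1`
    simp only [one_mul]
    refine ⟨mul_pos (inv_pos.mpr h1p) (inv_pos.mpr h1p), ?_⟩
    rw [if_neg (by norm_num), Real.log_mul (inv_pos.mpr h1p).ne' (inv_pos.mpr h1p).ne', Real.log_inv]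
    have : 4 * p⁻¹ = 4 / p := by rw [inv_eq_one_div, mul_one_div]
    have : 0 ≤ 2 / p ^ 2 := by positivity
    linarith
  · -- `c = −1`
    have h1p' : 0 < 1 - -1 * p⁻¹ := by linarith
    refine ⟨mul_pos (inv_pos.mpr h1p) (inv_pos.mpr h1p'), ?_⟩
    rw [if_pos rfl, add_zero, Real.log_mul (inv_pos.mpr h1p).ne' (inv_pos.mpr h1p').ne', Real.log_inv,
      Real.log_inv, show -Real.log (1 - p⁻¹) + -Real.log (1 - -1 * p⁻¹) =
        -(Real.log (1 - p⁻¹) + Real.log (1 - -1 * p⁻¹)) by ring,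
      ← Real.log_mul h1p.ne' h1p'.ne']
    have hfac : (1 - p⁻¹) * (1 - -1 * p⁻¹) = 1 - 1 / p ^ 2 := by field_simp; ring
    rw [hfac]
    have hu0 : (0 : ℝ) ≤ 1 / p ^ 2 := by positivity
    have hu1 : 1 / p ^ 2 ≤ 1 / 2 := by rw [div_le_div_iff₀ hp2 (by norm_num)]; nlinarith
    have := (abs_le.mp (abs_log_one_sub_le hu0 hu1)).1
    have e : 2 * (1 / p ^ 2) = 2 / p ^ 2 := by ring
    linarith

/-! ### Sums over the primes of `(s, X]` -/

variable {q : ℕ} [NeZero q] (χ : DirichletCharacter ℂ q)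

omit [NeZero q] in
/-- The real value `Re χ(p)` of a quadratic character is `0`, `1` or `−1`, and it is `−1` iff
`χ(p) = −1`. [folklore] -/
theorem re_apply_trichotomy (hquad : χ.IsQuadratic) (p : ℕ) :
    ((χ (p : ZMod q)).re = 0 ∨ (χ (p : ZMod q)).re = 1 ∨ (χ (p : ZMod q)).re = -1) ∧
      ((χ (p : ZMod q)).re = -1 ↔ χ (p : ZMod q) = -1) := by
  rcases hquad (p : ZMod q) with h | h | h <;> simp [h, Complex.ext_iff]

omit [NeZero q] in
/-- **`|∑_{s < p ≤ X} log κ_p| ≤ 16/(s+1)`** for `s ≥ 2` and weights `ω(p) = 1 + χ(p)`.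
[cite: GranvilleMollin2000, §8 (first display)] -/
theorem abs_sum_log_kappa_le (hquad : χ.IsQuadratic) {ω : ℕ → ℝ}
    (hω : ∀ p : ℕ, p.Prime → ω p = 1 + (χ (p : ZMod q)).re) {s X : ℕ} (hs : 2 ≤ s) :
    |∑ p ∈ (Nat.primesLE X).filter (fun p => s < p),
        (Real.log (1 - ω p / p) - Real.log (1 - 1 / p) - Real.log (1 - (χ (p : ZMod q)).re / p))| ≤
      16 / ((s : ℝ) + 1) := by
  calc |∑ p ∈ (Nat.primesLE X).filter (fun p => s < p),
        (Real.log (1 - ω p / p) - Real.log (1 - 1 / p) - Real.log (1 - (χ (p : ZMod q)).re / p))|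
      ≤ ∑ p ∈ (Nat.primesLE X).filter (fun p => s < p),
          |Real.log (1 - ω p / p) - Real.log (1 - 1 / p) - Real.log (1 - (χ (p : ZMod q)).re / p)| :=
        abs_sum_le_sum_abs _ _
    _ ≤ ∑ p ∈ (Nat.primesLE X).filter (fun p => s < p), 8 / (p : ℝ) ^ 2 := by
        refine sum_le_sum fun p hp => ?_
        rw [mem_filter, Nat.mem_primesLE] at hp
        have hp3 : (3 : ℝ) ≤ p := by exact_mod_cast (show 3 ≤ p by omega)
        rw [hω p hp.1.2]
        exact abs_log_kappa_le (re_apply_trichotomy χ hquad p).1 hp3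
    _ ≤ ∑ n ∈ Ioo s (X + 1), 8 / (n : ℝ) ^ 2 :=
        sum_le_sum_of_subset_of_nonneg (primesLE_filter_lt_subset_Ioo s X) (fun n _ _ => by positivity)
    _ = 8 * ∑ n ∈ Ioo s (X + 1), ((n : ℝ) ^ 2)⁻¹ := by
        rw [mul_sum]; refine sum_congr rfl fun n _ => ?_; rw [div_eq_mul_inv]
    _ ≤ 8 * (2 / ((s : ℝ) + 1)) := by gcongr; exact sum_Ioo_inv_sq_le s (X + 1)
    _ = 16 / ((s : ℝ) + 1) := by ring

omit [NeZero q] in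
/-- **`∑_{s < p ≤ X} log π_p ≤ 4 ∑_{s < p* ≤ X} 1/p* + 4/(s+1)`**: the Euler factors
beyond `s` are carried by the exceptional primes `p*` (`χ(p*) ≠ −1`).
[cite: TaoTeravainen2021, §3.3] -/
theorem sum_log_eulerFactor_le (hquad : χ.IsQuadratic) (s X : ℕ) :
    (∀ p ∈ (Nat.primesLE X).filter (fun p => s < p),
        0 < (1 - (p : ℝ)⁻¹)⁻¹ * (1 - (χ (p : ZMod q)).re * (p : ℝ)⁻¹)⁻¹) ∧
    ∑ p ∈ (Nat.primesLE X).filter (fun p => s < p),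
        Real.log ((1 - (p : ℝ)⁻¹)⁻¹ * (1 - (χ (p : ZMod q)).re * (p : ℝ)⁻¹)⁻¹) ≤
      4 * ∑ p ∈ ((Nat.primesLE X).filter (fun p : ℕ => s < p)).filter
          (fun p : ℕ => χ (p : ZMod q) ≠ -1), (1 : ℝ) / p + 4 / ((s : ℝ) + 1) := by
  set S := (Nat.primesLE X).filter (fun p : ℕ => s < p) with hS
  have hmem : ∀ p ∈ S, p.Prime ∧ s < p := fun p hp => by
    rw [hS, mem_filter, Nat.mem_primesLE] at hp; exact ⟨hp.1.2, hp.2⟩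
  have hfac : ∀ p ∈ S, 0 < (1 - (p : ℝ)⁻¹)⁻¹ * (1 - (χ (p : ZMod q)).re * (p : ℝ)⁻¹)⁻¹ ∧
      Real.log ((1 - (p : ℝ)⁻¹)⁻¹ * (1 - (χ (p : ZMod q)).re * (p : ℝ)⁻¹)⁻¹) ≤
        2 / (p : ℝ) ^ 2 + (if (χ (p : ZMod q)).re = -1 then (0 : ℝ) else 4 / (p : ℝ)) := fun p hp =>
    log_eulerFactor_le (p := (p : ℝ)) (re_apply_trichotomy χ hquad p).1
      (by exact_mod_cast (hmem p hp).1.two_le)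
  refine ⟨fun p hp => (hfac p hp).1, ?_⟩
  have h1 : ∑ p ∈ S, Real.log ((1 - (p : ℝ)⁻¹)⁻¹ * (1 - (χ (p : ZMod q)).re * (p : ℝ)⁻¹)⁻¹) ≤
      ∑ p ∈ S, (2 / (p : ℝ) ^ 2) + ∑ p ∈ S, (if (χ (p : ZMod q)).re = -1 then (0 : ℝ) else 4 / (p : ℝ)) := by
    rw [← sum_add_distrib]
    exact sum_le_sum fun p hp => (hfac p hp).2
  have h2 : ∑ p ∈ S, (2 / (p : ℝ) ^ 2) ≤ 4 / ((s : ℝ) + 1) :=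
    calc ∑ p ∈ S, (2 / (p : ℝ) ^ 2) ≤ ∑ n ∈ Ioo s (X + 1), 2 / (n : ℝ) ^ 2 :=
          sum_le_sum_of_subset_of_nonneg (primesLE_filter_lt_subset_Ioo s X) (fun n _ _ => by positivity)
      _ = 2 * ∑ n ∈ Ioo s (X + 1), ((n : ℝ) ^ 2)⁻¹ := by
          rw [mul_sum]; refine sum_congr rfl fun n _ => ?_; rw [div_eq_mul_inv]
      _ ≤ 2 * (2 / ((s : ℝ) + 1)) := by gcongr; exact sum_Ioo_inv_sq_le s (X + 1)
      _ = 4 / ((s : ℝ) + 1) := by ring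
  have h3 : ∑ p ∈ S, (if (χ (p : ZMod q)).re = -1 then (0 : ℝ) else 4 / (p : ℝ)) =
      4 * ∑ p ∈ S.filter (fun p : ℕ => χ (p : ZMod q) ≠ -1), (1 : ℝ) / p := by
    conv_rhs => rw [mul_sum, sum_filter]
    refine sum_congr rfl fun p _ => ?_
    have hiff := (re_apply_trichotomy χ hquad p).2
    by_cases h : χ (p : ZMod q) = -1
    · rw [if_pos (hiff.mpr h), if_neg (not_not.mpr h)]
    · rw [if_neg (fun h' => h (hiff.mp h')), if_pos h]; ring
  rw [h3] at h1
  linarith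

/-! ### Proposition 2 -/

/-- `‖L(1, χ)‖ = Re L(1, χ) > 0` for a non-principal quadratic character. [folklore] -/
theorem norm_LFunction_one_eq_re (hχ : χ ≠ 1) (hq : χ ^ 2 = 1) :
    0 < (χ.LFunction 1).re ∧ ‖χ.LFunction 1‖ = (χ.LFunction 1).re := by
  have hL1pos : 0 < (χ.LFunction 1).re := by
    have h := ZetaMul.LOne_pos χ hχ hq
    rwa [ZetaMul.LOne] at h
  have hL1im : (χ.LFunction 1).im = 0 := by
    have := DirichletAbel.LFunction_ofReal_im_eq_zero χ hχ hq (σ := 1) one_pos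
    simpa using this
  refine ⟨hL1pos, ?_⟩
  rw [← Complex.re_add_im (χ.LFunction 1), hL1im]
  simp [abs_of_pos hL1pos]

set_option maxHeartbeats 4000000 in
/-- **Granville–Mollin 2000, Proposition 2, discharged** (`GranvilleMollin2000_prop2`): for every
`ε > 0` there are `η₀, d₀` such that for every negative fundamental `d ≡ 1 (mod 4)` with `|d| ≥ d₀`,
every zero `1 − 1/(η log|d|)` of `L(s, (d/·))` with `η ≥ η₀`, and the Bateman–Horn constant `c_f`
of `f_d = x² + x + (1 − d)/4`: `|ϱ_d − c_f/(η log|d|)| ≤ ε c_f/(η log|d|)`. The proof is the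
elementary route described in the module docstring (Tao–Teräväinen positivity in place of the
explicit formula (3.3) of the printed §8). [cite: GranvilleMollin2000, Proposition 2 and §8]
[cite: TaoTeravainen2021, §3.3 and Proposition 3.5] -/
theorem GranvilleMollin2000_prop2_holds : GranvilleMollin2000_prop2 := by
  intro ε hε
  -- reduce to `ε' = min ε 1`
  set ε' : ℝ := min ε 1 with hε'_def
  have hε' : 0 < ε' := lt_min hε one_pos
  have hε'1 : ε' ≤ 1 := min_le_right _ _
  have hε'ε : ε' ≤ ε := min_le_left _ _
  -- the analytic inputs (all theorems of the tree)
  obtain ⟨ηh, Hh⟩ := exists_abs_harmSum_sub_le (ε := 1) one_pos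
  obtain ⟨C, ηD, hC, hηD, HD⟩ := ExceptionalZero.exists_abs_sub_le_div_eta
  obtain ⟨K₁, η₁, H₁⟩ := TaoTeravainen2021_eq313_holds 1 one_pos
  obtain ⟨K₂, η₂, H₂⟩ := TaoTeravainen2021_eq314_holds 1 one_pos
  set K₁' : ℝ := max K₁ 0 with hK₁'
  set K₂' : ℝ := max K₂ 0 with hK₂'
  have hK₁'0 : 0 ≤ K₁' := le_max_right _ _
  have hK₂'0 : 0 ≤ K₂' := le_max_right _ _
  -- the parameters: `u` (so that `2e^{24−u} ≤ ε'/8`), then `η₀`, then `d₀`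
  set u : ℝ := 27 + 16 / ε' with hu_def
  have hu27 : 27 ≤ u := by rw [hu_def]; linarith [div_pos (by norm_num : (0 : ℝ) < 16) hε']
  have hu1 : 1 ≤ u := by linarith
  have hu0 : 0 < u := by linarith
  set A₁ : ℝ := 16 * (C + u + 3) / ε' with hA₁
  set A₂ : ℝ := (128 * K₂' / ε') ^ 2 with hA₂
  set A₃ : ℝ := 64 * K₁' * (u + 1) / ε' with hA₃
  have hA₁0 : 0 ≤ A₁ := by positivity
  have hA₂0 : 0 ≤ A₂ := by positivity
  have hA₃0 : 0 ≤ A₃ := by positivity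
  refine ⟨max ηh 0 + max ηD 0 + max η₁ 0 + max η₂ 0 + A₁ + A₂ + A₃ + 1,
    (160 / ε') ^ 2 + 10 ^ 4, ?_⟩
  intro d hd hdd q _ hqd χ hprim hquad η hη hzero c₀ hc₀
  -- from `d` to `q`
  obtain ⟨hdq, hq4, hodd, hsqf⟩ := negFundOne_facts hd hqd
  have habs : |(d : ℝ)| = q := by
    rw [hdq]; push_cast; rw [abs_neg, Nat.abs_cast]
  rw [habs] at hdd hzero ⊢
  -- the two cases `q ≡ 3, 7 (mod 8)`
  rcases (show q % 8 = 3 ∨ q % 8 = 7 by omega) with hq8 | hq8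
  swap
  · -- `q ≡ 7 (mod 8)`: `ω(2) = 2`, the partial products vanish, `c₀ = 0 = ϱ_d`
    have hev : ∀ᶠ X : ℕ in atTop,
        (0 : ℝ) = Literature.NumberTheory.Sieve.batemanHornPartial ![rabinowitschPoly d] X :=
      eventually_atTop.2 ⟨2, fun X hX => (batemanHornPartial_rabinowitsch_eq_zero hdq hq8 hX).symm⟩
    have hc0 : c₀ = 0 := tendsto_nhds_unique hc₀ (tendsto_const_nhds.congr' hev)
    have hϱ0 : gmRho d = 0 := gmRho_eq_zero hdq hq8 (by omega)
    rw [hc0, hϱ0]; simp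
  -- `q ≡ 3 (mod 8)`: sizes of `q`
  have h160 : (0 : ℝ) ≤ (160 / ε') ^ 2 := by positivity
  have hq4' : (10 : ℝ) ^ 4 ≤ q := by linarith
  have hq160 : (160 / ε') ^ 2 ≤ (q : ℝ) := by linarith [show (0 : ℝ) ≤ 10 ^ 4 by norm_num]
  have hq0 : (0 : ℝ) < q := by linarith
  have hq1 : (1 : ℝ) < q := by linarith
  have hq2 : 2 ≤ q := by exact_mod_cast (show (2 : ℝ) ≤ q by linarith)
  have hχ1 : χ ≠ 1 := ne_one_of_isPrimitive hq2 hprim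
  have hχsq : χ ^ 2 = 1 := hquad.sq_eq_one
  set L : ℝ := Real.log q with hLdef
  have hL1 : 1 < L := by
    rw [hLdef, Real.lt_log_iff_exp_lt hq0]
    have := Real.exp_one_lt_d9
    linarith
  have hL0 : 0 < L := by linarith
  -- `s₀ = ⌊√q⌋`
  set s₀ : ℕ := ⌊Real.sqrt q⌋₊ with hs₀def
  have hsqrt100 : (100 : ℝ) ≤ Real.sqrt q := by
    rw [show (100 : ℝ) = Real.sqrt ((10 : ℝ) ^ 4) by
      rw [show ((10 : ℝ) ^ 4) = 100 ^ 2 by norm_num, Real.sqrt_sq (by norm_num)]]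
    exact Real.sqrt_le_sqrt hq4'
  have hsqrtε : 160 / ε' ≤ Real.sqrt q := by
    rw [show 160 / ε' = Real.sqrt ((160 / ε') ^ 2) by rw [Real.sqrt_sq (by positivity)]]
    exact Real.sqrt_le_sqrt hq160
  have hs₀100 : 100 ≤ s₀ := Nat.le_floor hsqrt100
  have hs₀R : (s₀ : ℝ) ≤ Real.sqrt q := Nat.floor_le (Real.sqrt_nonneg _)
  have hs₀lt : Real.sqrt q < (s₀ : ℝ) + 1 := Nat.lt_floor_add_one _
  have hs₀1 : (160 / ε') ≤ (s₀ : ℝ) + 1 := by linarith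
  have hs₀pos : (0 : ℝ) < (s₀ : ℝ) + 1 := by positivity
  have hsqq : Real.sqrt q ≤ q := by
    have h := Real.sqrt_le_sqrt hq1.le
    rw [Real.sqrt_one] at h
    calc Real.sqrt q = Real.sqrt q * 1 := by ring
      _ ≤ Real.sqrt q * Real.sqrt q := by gcongr
      _ = q := Real.mul_self_sqrt hq0.le
  have hs₀q : s₀ ≤ q := by exact_mod_cast hs₀R.trans hsqq
  -- the character at `1`
  obtain ⟨hL1pos, hnorm⟩ := norm_LFunction_one_eq_re χ hχ1 hχsq
  set L1 : ℝ := (χ.LFunction 1).re with hL1def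
  set L1' : ℝ := (deriv χ.LFunction 1).re with hL1'def
  -- the quality `η`
  have hmax : ∀ a : ℝ, a ≤ max a 0 := fun a => le_max_left _ _
  have hmax0 : ∀ a : ℝ, 0 ≤ max a 0 := fun a => le_max_right _ _
  have hηh : ηh ≤ η := by linarith [hmax ηh, hmax0 ηD, hmax0 η₁, hmax0 η₂]
  have hηD' : ηD ≤ η := by linarith [hmax0 ηh, hmax ηD, hmax0 η₁, hmax0 η₂]
  have hη₁ : η₁ ≤ η := by linarith [hmax0 ηh, hmax0 ηD, hmax η₁, hmax0 η₂]
  have hη₂ : η₂ ≤ η := by linarith [hmax0 ηh, hmax0 ηD, hmax0 η₁, hmax η₂]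
  have hηA₁ : A₁ ≤ η := by linarith [hmax0 ηh, hmax0 ηD, hmax0 η₁, hmax0 η₂]
  have hηA₂ : A₂ ≤ η := by linarith [hmax0 ηh, hmax0 ηD, hmax0 η₁, hmax0 η₂]
  have hηA₃ : A₃ ≤ η := by linarith [hmax0 ηh, hmax0 ηD, hmax0 η₁, hmax0 η₂]
  have hη1 : 1 ≤ η := by linarith [hmax0 ηh, hmax0 ηD, hmax0 η₁, hmax0 η₂]
  have hη0 : 0 < η := by linarith
  have hηL : 0 < η * L := mul_pos hη0 hL0
  -- the error parameters `ρ₁`, `ρ₂` and their sizes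
  set ρ₁ : ℝ := (C + u + 3) / η with hρ₁
  set ρ₂ : ℝ := 2 * K₂' / η ^ ((1 : ℝ) / 2) + K₁' * (u + 1) / η with hρ₂
  have hρ₁0 : 0 ≤ ρ₁ := by positivity
  have hρ₂0 : 0 ≤ ρ₂ := by positivity
  have hρ₁ε : 2 * ρ₁ ≤ ε' / 8 := by
    rw [hρ₁, mul_div_assoc', div_le_iff₀ hη0]
    have h : 16 * (C + u + 3) / ε' ≤ η := hηA₁
    rw [div_le_iff₀ hε'] at h
    linarith
  have hρ₁half : ρ₁ ≤ 1 / 2 := by linarith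
  have hρ₂ε : 4 * ρ₂ ≤ ε' / 8 := by
    have hsq : 128 * K₂' / ε' ≤ η ^ ((1 : ℝ) / 2) := by
      have h1 : Real.sqrt A₂ ≤ Real.sqrt η := Real.sqrt_le_sqrt hηA₂
      rw [hA₂, Real.sqrt_sq (by positivity), Real.sqrt_eq_rpow] at h1
      exact h1
    have hpow0 : 0 < η ^ ((1 : ℝ) / 2) := Real.rpow_pos_of_pos hη0 _
    have e1 : 2 * K₂' / η ^ ((1 : ℝ) / 2) ≤ ε' / 64 := by
      rw [div_le_iff₀ hpow0]
      have h := mul_le_mul_of_nonneg_left hsq (show (0 : ℝ) ≤ ε' / 64 by positivity)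
      have : ε' / 64 * (128 * K₂' / ε') = 2 * K₂' := by field_simp; ring
      linarith
    have e2 : K₁' * (u + 1) / η ≤ ε' / 64 := by
      rw [div_le_iff₀ hη0]
      have h : 64 * K₁' * (u + 1) / ε' ≤ η := hηA₃
      rw [div_le_iff₀ hε'] at h
      linarith
    rw [hρ₂]; linarith
  have hexpu : 2 * Real.exp (24 - u) ≤ ε' / 8 := by
    have h1 : Real.exp (24 - u) ≤ Real.exp (-(16 / ε')) := Real.exp_le_exp.mpr (by rw [hu_def]; linarith)
    -- `e^{−x} ≤ 1/x` for `x = 16/ε' > 0`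
    have h2 : Real.exp (-(16 / ε')) ≤ 1 / (16 / ε') := by
      have hx : (0 : ℝ) < 16 / ε' := by positivity
      rw [Real.exp_neg, inv_eq_one_div, div_le_div_iff₀ (Real.exp_pos _) hx]
      linarith [Real.add_one_le_exp (16 / ε')]
    have h3 : 1 / (16 / ε') = ε' / 16 := by field_simp
    linarith
  have hexpu_half : Real.exp (24 - u) ≤ 1 / 2 := by linarith
  have hs₀ε : 20 / ((s₀ : ℝ) + 1) ≤ ε' / 8 := by
    rw [div_le_iff₀ hs₀pos]
    have h := mul_le_mul_of_nonneg_left hs₀1 (show (0 : ℝ) ≤ ε' / 8 by positivity)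
    have : ε' / 8 * (160 / ε') = 20 := by field_simp; ring
    linarith
  -- `T = η L · L(1, χ)`
  set T : ℝ := η * L * L1 with hTdef
  have hT0 : 0 < T := mul_pos hηL hL1pos
  /- ### Step 1: `G(N) = T (1 + O(ρ₁))` at `N = ⌈q^u⌉` -/
  set N : ℕ := ⌈(q : ℝ) ^ u⌉₊ with hNdef
  have hqu : (q : ℝ) ^ u ≤ N := Nat.le_ceil _
  have hqu1 : (q : ℝ) ≤ (q : ℝ) ^ u := by
    have := Real.rpow_le_rpow_of_exponent_le hq1.le hu1
    rwa [Real.rpow_one] at this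
  have hqN : (q : ℝ) ≤ N := hqu1.trans hqu
  have hNq' : (q : ℝ) ^ ((1 + 1) / 2 : ℝ) ≤ N := by
    have e : ((1 + 1) / 2 : ℝ) = 1 := by norm_num
    rw [e, Real.rpow_one]; exact hqN
  have hN1 : 1 ≤ N := by exact_mod_cast (show (1 : ℝ) ≤ N by linarith)
  have hN0 : (0 : ℝ) < N := by exact_mod_cast (show 0 < N by omega)
  have hNlt : (N : ℝ) < (q : ℝ) ^ u + 1 := Nat.ceil_lt_add_one (by positivity)
  have hlogN : Real.log N ≤ u * L + 1 := by
    have h2 : (N : ℝ) ≤ 2 * (q : ℝ) ^ u := by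
      have : (1 : ℝ) ≤ (q : ℝ) ^ u := by linarith
      linarith
    have h := Real.log_le_log hN0 h2
    rw [Real.log_mul (by norm_num) (by positivity), Real.log_rpow hq0] at h
    have hlog2 : Real.log 2 ≤ 1 := by
      have := Real.log_le_sub_one_of_pos (by norm_num : (0 : ℝ) < 2); linarith
    linarith
  have hlogNge : u * L ≤ Real.log N := by
    have h := Real.log_le_log (by positivity) hqu
    rwa [Real.log_rpow hq0] at h
  have hlogN0 : 0 < Real.log N := lt_of_lt_of_le (by positivity) hlogNge
  set G : ℝ := ∑ n ∈ Icc 1 N, (χ.zetaMul n).re / n with hGdef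
  have hG := Hh q χ hprim hχsq η hηh hzero N hNq'
  have hD := HD q χ hχ1 hχsq hq2 η hηD' hzero
  -- `|G − T| ≤ ρ₁ T`
  have hGT : |G - T| ≤ ρ₁ * T := by
    -- `L1' = ηL (L1 + θ (C/η) L1)`
    have hD' : |L1' - T| ≤ C / η * L1 * (η * L) := by
      have h := mul_le_mul_of_nonneg_right hD hηL.le
      rw [← abs_of_pos hηL, ← abs_mul, abs_of_pos hηL] at h
      have hne : η * Real.log q ≠ 0 := by rw [← hLdef]; exact hηL.ne'
      have : (1 / (η * Real.log q) * L1' - L1) * (η * L) = L1' - T := by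
        rw [hTdef, hLdef, sub_mul, one_div, inv_mul_eq_div, div_mul_cancel₀ _ hne]; ring
      rwa [this] at h
    have hG' : |G - (L1' + (Real.log N + Real.eulerMascheroniConstant) * L1)| ≤ L1 := hG
    have hγ : Real.eulerMascheroniConstant ≤ 1 := by
      have := Real.eulerMascheroniConstant_lt_two_thirds; linarith
    have hγ0 : 0 ≤ Real.eulerMascheroniConstant := by
      have := Real.one_half_lt_eulerMascheroniConstant; linarith
    -- `|G − T| ≤ |G − main| + |L1' − T| + (log N + γ) L1`
    have h1 : |G - T| ≤ L1 + C / η * L1 * (η * L) + (Real.log N + Real.eulerMascheroniConstant) * L1 := by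
      have htri : |G - T| ≤ |G - (L1' + (Real.log N + Real.eulerMascheroniConstant) * L1)| +
          |L1' - T| + |(Real.log N + Real.eulerMascheroniConstant) * L1| := by
        have e : G - T = (G - (L1' + (Real.log N + Real.eulerMascheroniConstant) * L1)) +
            (L1' - T) + (Real.log N + Real.eulerMascheroniConstant) * L1 := by ring
        rw [e]
        exact abs_add_three _ _ _
      have h3 : |(Real.log N + Real.eulerMascheroniConstant) * L1| =
          (Real.log N + Real.eulerMascheroniConstant) * L1 :=
        abs_of_nonneg (mul_nonneg (by linarith) hL1pos.le)
      linarith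
    -- compare with `ρ₁ T = (C + u + 3) L L1`
    have h2 : L1 + C / η * L1 * (η * L) + (Real.log N + Real.eulerMascheroniConstant) * L1 ≤ ρ₁ * T := by
      have e1 : C / η * L1 * (η * L) = C * L * L1 := by field_simp
      have e2 : ρ₁ * T = (C + u + 3) * L * L1 := by rw [hρ₁, hTdef]; field_simp
      rw [e1, e2]
      have : L1 + (Real.log N + Real.eulerMascheroniConstant) * L1 ≤ (u + 3) * L * L1 := by
        have : (1 + Real.log N + Real.eulerMascheroniConstant) ≤ (u + 3) * L := by nlinarith
        nlinarith
      nlinarith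
    exact h1.trans h2
  have hGup : G ≤ T * (1 + ρ₁) := by have := (abs_le.mp hGT).2; linarith
  have hGlo : T * (1 - ρ₁) ≤ G := by have := (abs_le.mp hGT).1; linarith
  /- ### Step 2: the sandwich for `P₀ = ∏_{p ≤ s₀} π_p` -/
  set P₀ : ℝ := ∏ p ∈ Nat.primesLE s₀, (1 - (p : ℝ)⁻¹)⁻¹ * (1 - (χ (p : ZMod q)).re * (p : ℝ)⁻¹)⁻¹
    with hP₀def
  have hfacpos : ∀ p : ℕ, p.Prime → 0 < (1 - (p : ℝ)⁻¹)⁻¹ * (1 - (χ (p : ZMod q)).re * (p : ℝ)⁻¹)⁻¹ :=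
    fun p hp => (log_eulerFactor_le (p := (p : ℝ)) (re_apply_trichotomy χ hquad p).1
      (by exact_mod_cast hp.two_le)).1
  have hP₀pos : 0 < P₀ := prod_pos fun p hp => hfacpos p (Nat.prime_of_mem_primesLE hp)
  -- upper bound by Rankin: `P₀ ≤ G + e^{24} N^{−1/log(s₀+1)} P₀ ≤ G + e^{24−u} P₀`
  have hPB : (s₀ + 1).primesBelow = Nat.primesLE s₀ := rfl
  have hup := SmoothEulerProduct.smoothProduct_le_sum_add_exp χ hχsq (M := s₀ + 1) (by omega) hN1
  rw [hPB] at hup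
  have hrank : Real.exp 24 * (N : ℝ) ^ (-(1 / Real.log ((s₀ + 1 : ℕ) : ℝ))) ≤ Real.exp (24 - u) := by
    have hM1 : (1 : ℝ) < ((s₀ + 1 : ℕ) : ℝ) := by push_cast; linarith
    have hlogM0 : 0 < Real.log ((s₀ + 1 : ℕ) : ℝ) := Real.log_pos hM1
    have hlogML : Real.log ((s₀ + 1 : ℕ) : ℝ) ≤ L := by
      rw [hLdef]
      refine Real.log_le_log (by positivity) ?_
      push_cast
      have : Real.sqrt q + 1 ≤ q := by nlinarith [Real.mul_self_sqrt hq0.le, hsqrt100]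
      linarith
    have hexp : (N : ℝ) ^ (-(1 / Real.log ((s₀ + 1 : ℕ) : ℝ))) ≤ Real.exp (-u) := by
      rw [Real.rpow_def_of_pos hN0, Real.exp_le_exp]
      have h1 : u ≤ Real.log N / Real.log ((s₀ + 1 : ℕ) : ℝ) := by
        rw [le_div_iff₀ hlogM0]
        calc u * Real.log ((s₀ + 1 : ℕ) : ℝ) ≤ u * L := mul_le_mul_of_nonneg_left hlogML hu0.le
          _ ≤ Real.log N := hlogNge
      have : Real.log N * -(1 / Real.log ((s₀ + 1 : ℕ) : ℝ)) = -(Real.log N / Real.log ((s₀ + 1 : ℕ) : ℝ)) := by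
        ring
      rw [this]; linarith
    calc Real.exp 24 * (N : ℝ) ^ (-(1 / Real.log ((s₀ + 1 : ℕ) : ℝ))) ≤ Real.exp 24 * Real.exp (-u) :=
          mul_le_mul_of_nonneg_left hexp (Real.exp_pos _).le
      _ = Real.exp (24 - u) := by rw [← Real.exp_add]; ring_nf
  have hupper : P₀ * (1 - Real.exp (24 - u)) ≤ T * (1 + ρ₁) := by
    have h1 : P₀ ≤ G + Real.exp (24 - u) * P₀ := by
      calc P₀ ≤ G + Real.exp 24 * (N : ℝ) ^ (-(1 / Real.log ((s₀ + 1 : ℕ) : ℝ))) * P₀ := hup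
        _ ≤ G + Real.exp (24 - u) * P₀ := by
            gcongr
    nlinarith
  -- lower bound by the smooth majorant: `G ≤ Π(N) = P₀ ∏_{s₀ < p ≤ N} π_p`
  have hNN : Nat.primesLE N = (N + 1).primesBelow := rfl
  have hlo := SmoothEulerProduct.sum_le_smoothProduct χ hχsq (x := N) (M := N + 1) (Nat.lt_succ_self N)
  have hs₀N : s₀ ≤ N := by exact_mod_cast (show (s₀ : ℝ) ≤ N by linarith)
  rw [← hNN, prod_primesLE_eq_mul_prod_filter_lt hs₀N] at hlo
  set S : Finset ℕ := (Nat.primesLE N).filter (fun p : ℕ => s₀ < p) with hSdef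
  obtain ⟨hSpos, hSlog⟩ := sum_log_eulerFactor_le χ hquad s₀ N
  -- the exceptional primes of `(s₀, N]`: (3.14) with `m = 2` on `(√q, q]`, (3.13) on `(q, N]`
  set E : ℝ := ∑ p ∈ S.filter (fun p : ℕ => χ (p : ZMod q) ≠ -1), (1 : ℝ) / p with hEdef
  have hE : E ≤ ρ₂ := by
    have hB := H₂ q χ hprim hquad η hη₂ hzero 2 le_rfl
    have hA := H₁ q χ hprim hquad η hη₁ hzero (N : ℝ) hNq'
    rw [Nat.floor_natCast] at hA
    have hhalf : (q : ℝ) ^ ((1 + 1) / (2 * ((2 : ℕ) : ℝ))) = Real.sqrt q := by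
      rw [Real.sqrt_eq_rpow]; norm_num
    have hone : (q : ℝ) ^ ((1 + 1) / (2 * (((2 : ℕ) : ℝ) - 1))) = q := by norm_num
    have hone' : (q : ℝ) ^ ((1 + 1) / 2 : ℝ) = q := by norm_num
    rw [hhalf, hone, Nat.floor_natCast] at hB
    rw [hone', Nat.floor_natCast] at hA
    set B2 : Finset ℕ := excPrimes χ (Ioc ⌊Real.sqrt q⌋₊ q) with hB2
    set A : Finset ℕ := excPrimes χ (Ioc q N) with hA'
    have hcover : S.filter (fun p : ℕ => χ (p : ZMod q) ≠ -1) ⊆ B2 ∪ A := by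
      intro p hp
      rw [mem_filter, hSdef, mem_filter, Nat.mem_primesLE] at hp
      obtain ⟨⟨⟨hpN, hpp⟩, hps⟩, hpχ⟩ := hp
      rw [mem_union]
      by_cases hpq : p ≤ q
      · left; rw [hB2, mem_excPrimes, mem_Ioc]; exact ⟨⟨hps, hpq⟩, hpp, hpχ⟩
      · right; rw [hA', mem_excPrimes, mem_Ioc]; exact ⟨⟨by omega, hpN⟩, hpp, hpχ⟩
    have hf : ∀ p : ℕ, 0 ≤ (1 : ℝ) / p := fun p => by positivity
    have hpowpos : 0 < η ^ ((1 : ℝ) / 2) := Real.rpow_pos_of_pos hη0 _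
    have hunion : ∑ p ∈ B2 ∪ A, (1 : ℝ) / p ≤ ∑ p ∈ B2, (1 : ℝ) / p + ∑ p ∈ A, (1 : ℝ) / p := by
      have h1 := Finset.sum_union_inter (s₁ := B2) (s₂ := A) (f := fun p : ℕ => (1 : ℝ) / p)
      have h2 : 0 ≤ ∑ p ∈ B2 ∩ A, (1 : ℝ) / p := Finset.sum_nonneg fun p _ => hf p
      linarith
    calc E ≤ ∑ p ∈ B2 ∪ A, (1 : ℝ) / p := sum_le_sum_of_subset_of_nonneg hcover fun p _ _ => hf p
      _ ≤ ∑ p ∈ B2, (1 : ℝ) / p + ∑ p ∈ A, (1 : ℝ) / p := hunion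
      _ ≤ K₂ * (2 : ℕ) / η ^ ((1 : ℝ) / (2 : ℕ)) + K₁ * (Real.log N / Real.log q) / η := add_le_add hB hA
      _ ≤ 2 * K₂' / η ^ ((1 : ℝ) / 2) + K₁' * (u + 1) / η := by
          have e1 : K₂ * (2 : ℕ) / η ^ ((1 : ℝ) / (2 : ℕ)) ≤ 2 * K₂' / η ^ ((1 : ℝ) / 2) := by
            push_cast
            exact div_le_div_of_nonneg_right (by linarith [le_max_left K₂ 0]) hpowpos.le
          have e2 : K₁ * (Real.log N / Real.log q) / η ≤ K₁' * (u + 1) / η := by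
            refine div_le_div_of_nonneg_right ?_ hη0.le
            have hr0 : 0 ≤ Real.log N / Real.log q := div_nonneg hlogN0.le hL0.le
            have hr1 : Real.log N / Real.log q ≤ u + 1 := by
              rw [div_le_iff₀ hL0]; nlinarith
            calc K₁ * (Real.log N / Real.log q) ≤ K₁' * (Real.log N / Real.log q) :=
                  mul_le_mul_of_nonneg_right (le_max_left _ _) hr0
              _ ≤ K₁' * (u + 1) := mul_le_mul_of_nonneg_left hr1 hK₁'0
          exact add_le_add e1 e2
  have hprodS : ∏ p ∈ S, (1 - (p : ℝ)⁻¹)⁻¹ * (1 - (χ (p : ZMod q)).re * (p : ℝ)⁻¹)⁻¹ ≤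
      Real.exp (4 * ρ₂ + 4 / ((s₀ : ℝ) + 1)) := by
    rw [← Real.exp_log (prod_pos fun p hp => hSpos p hp), Real.exp_le_exp, Real.log_prod (fun p hp => (hSpos p hp).ne')]
    calc _ ≤ 4 * E + 4 / ((s₀ : ℝ) + 1) := hSlog
      _ ≤ 4 * ρ₂ + 4 / ((s₀ : ℝ) + 1) := by linarith
  have hlower : T * (1 - ρ₁) ≤ P₀ * Real.exp (4 * ρ₂ + 4 / ((s₀ : ℝ) + 1)) :=
    hGlo.trans (hlo.trans (mul_le_mul_of_nonneg_left hprodS hP₀pos.le))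
  -- the main lemma: `|log P₀ − log T| ≤ δ_b`
  set δ : ℝ := 2 * ρ₁ + 4 * ρ₂ + 4 / ((s₀ : ℝ) + 1) + 2 * Real.exp (24 - u) with hδdef
  have hmain : |Real.log P₀ - Real.log T| ≤ δ := by
    rw [abs_le]
    constructor
    · -- lower: `log T + log(1 − ρ₁) ≤ log P₀ + 4ρ₂ + 4/(s₀+1)`
      have h1ρ : 0 < 1 - ρ₁ := by linarith
      have h := Real.log_le_log (mul_pos hT0 h1ρ) hlower
      rw [Real.log_mul hT0.ne' h1ρ.ne', Real.log_mul hP₀pos.ne' (Real.exp_pos _).ne', Real.log_exp] at h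
      have hl : -(2 * ρ₁) ≤ Real.log (1 - ρ₁) := by
        have := (abs_le.mp (abs_log_one_sub_le hρ₁0 hρ₁half)).1; linarith
      have : 0 ≤ 2 * Real.exp (24 - u) := by positivity
      rw [hδdef]; linarith
    · -- upper: `log P₀ + log(1 − e^{24−u}) ≤ log T + log(1 + ρ₁)`
      have h1e : 0 < 1 - Real.exp (24 - u) := by linarith
      have h := Real.log_le_log (mul_pos hP₀pos h1e) hupper
      rw [Real.log_mul hP₀pos.ne' h1e.ne', Real.log_mul hT0.ne' (by linarith : (1 + ρ₁) ≠ 0)] at h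
      have hl1 : Real.log (1 + ρ₁) ≤ ρ₁ := (log_one_add_le_self hρ₁0).2
      have hl2 : -(2 * Real.exp (24 - u)) ≤ Real.log (1 - Real.exp (24 - u)) := by
        have := (abs_le.mp (abs_log_one_sub_le (Real.exp_pos _).le hexpu_half)).1; linarith
      have : 0 ≤ 4 / ((s₀ : ℝ) + 1) := by positivity
      rw [hδdef]; linarith
  /- ### Step 3: the per-`X` estimate and the limit `X → ∞` -/
  obtain ⟨K', hK'⟩ := CharacterMertens.exists_abs_sum_primesLE_re_mul_log_div_le χ hχ1 hχsq
  have hK'0 : 0 ≤ K' := le_trans (abs_nonneg _) (hK' 0)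
  have hϱ : 0 < gmRho d := gmRho_pos hdq hq8
  have hτ : 0 < gmRho d * (η * L) := mul_pos hϱ hηL
  set Btot : ℝ := δ + 16 / ((s₀ : ℝ) + 1) with hBtot
  have hBε : Btot ≤ ε' / 2 := by
    rw [hBtot, hδdef]
    have : 4 / ((s₀ : ℝ) + 1) + 16 / ((s₀ : ℝ) + 1) = 20 / ((s₀ : ℝ) + 1) := by ring
    linarith
  -- the limit lemma
  have hlim : 0 < c₀ ∧ |Real.log c₀ - Real.log (gmRho d * (η * L))| ≤ Btot := by
    refine pos_and_abs_log_sub_le_of_tendsto (r := fun X : ℕ => 2 * K' / Real.log ((X : ℝ) + 1) + 4 / ((X : ℝ) + 1))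
      hτ hc₀ ?_ ?_
    · -- `r(X) → 0`
      have h1 : Tendsto (fun X : ℕ => (X : ℝ) + 1) atTop atTop :=
        tendsto_atTop_add_const_right _ 1 tendsto_natCast_atTop_atTop
      have hlog : Tendsto (fun X : ℕ => Real.log ((X : ℝ) + 1)) atTop atTop := Real.tendsto_log_atTop.comp h1
      have ha : Tendsto (fun X : ℕ => 2 * K' / Real.log ((X : ℝ) + 1)) atTop (𝓝 0) := by
        have := hlog.inv_tendsto_atTop.const_mul (2 * K')
        simpa [div_eq_mul_inv] using this
      have hb : Tendsto (fun X : ℕ => 4 / ((X : ℝ) + 1)) atTop (𝓝 0) := by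
        have := h1.inv_tendsto_atTop.const_mul 4
        simpa [div_eq_mul_inv] using this
      simpa using ha.add hb
    · -- the eventual bound, for `X ≥ s₀`
      filter_upwards [eventually_ge_atTop s₀] with X hX
      have hX1 : 1 ≤ X := le_trans (by omega) hX
      refine ⟨batemanHornPartial_rabinowitsch_pos hdq hq8 X, ?_⟩
      -- the pieces
      set a : ℕ → ℝ := fun p => -Real.log (1 - (p : ℝ)⁻¹) with hadef
      set b : ℕ → ℝ := fun p => -Real.log (1 - (χ (p : ZMod q)).re / p) with hbdef
      set w : ℕ → ℝ := fun p => Real.log (1 - (polyRootCountMod ![rabinowitschPoly d] p : ℝ) / p) with hwdef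
      have hωre : ∀ p : ℕ, p.Prime → (polyRootCountMod ![rabinowitschPoly d] p : ℝ) = 1 + (χ (p : ZMod q)).re :=
        fun p hp => by rw [polyRootCountMod_eq_one_add_reChar hd hqd χ hprim hquad hp, reChar_apply χ hp.ne_zero]
      -- `log B(X) = ∑_{p ≤ X} a + log ϱ + ∑_{s₀ < p ≤ X} w`
      have hlogB := log_batemanHornPartial_rabinowitsch hdq hq8 hX
      rw [Literature.NumberTheory.LFunctions.Nicolas.mertensLog_natCast] at hlogB
      -- `log P₀ = ∑_{p ≤ s₀} (a + b)`
      have hlogP₀ : Real.log P₀ = ∑ p ∈ Nat.primesLE s₀, (a p + b p) := by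
        rw [hP₀def, Real.log_prod (fun p hp => (hfacpos p (Nat.prime_of_mem_primesLE hp)).ne')]
        refine sum_congr rfl fun p hp => ?_
        have hpp := Nat.prime_of_mem_primesLE hp
        have hp2 : (2 : ℝ) ≤ p := by exact_mod_cast hpp.two_le
        have hp0 : (0 : ℝ) < p := by linarith
        have h1 : 0 < 1 - (p : ℝ)⁻¹ := by
          rw [sub_pos, inv_lt_one_iff₀]; right; linarith
        have h2 : 0 < 1 - (χ (p : ZMod q)).re * (p : ℝ)⁻¹ := by
          have hre : (χ (p : ZMod q)).re ≤ 1 := by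
            rcases (re_apply_trichotomy χ hquad p).1 with h | h | h <;> rw [h] <;> norm_num
          have : (χ (p : ZMod q)).re * (p : ℝ)⁻¹ ≤ (p : ℝ)⁻¹ := by
            have := mul_le_mul_of_nonneg_right hre (inv_pos.mpr hp0).le
            rwa [one_mul] at this
          linarith
        rw [Real.log_mul (inv_pos.mpr h1).ne' (inv_pos.mpr h2).ne', Real.log_inv, Real.log_inv]
        simp only [hadef, hbdef, div_eq_mul_inv]
      -- the sums over `(s₀, X]` as differences
      set SX : Finset ℕ := (Nat.primesLE X).filter (fun p : ℕ => s₀ < p) with hSX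
      have hsa : ∑ p ∈ SX, a p = ∑ p ∈ Nat.primesLE X, a p - ∑ p ∈ Nat.primesLE s₀, a p :=
        sum_primesLE_filter_lt hX a
      have hsb : ∑ p ∈ SX, b p = ∑ p ∈ Nat.primesLE X, b p - ∑ p ∈ Nat.primesLE s₀, b p :=
        sum_primesLE_filter_lt hX b
      -- `∑_{s₀ < p ≤ X} (w + a + b) = ∑ log κ_p`, small
      have hkappa : |∑ p ∈ SX, (w p + a p + b p)| ≤ 16 / ((s₀ : ℝ) + 1) := by
        have h := abs_sum_log_kappa_le χ hquad (ω := fun p => (polyRootCountMod ![rabinowitschPoly d] p : ℝ))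
          hωre (s := s₀) (X := X) (by omega)
        have heq : ∑ p ∈ SX, (w p + a p + b p) = ∑ p ∈ (Nat.primesLE X).filter (fun p : ℕ => s₀ < p),
            (Real.log (1 - (polyRootCountMod ![rabinowitschPoly d] p : ℝ) / p) - Real.log (1 - 1 / p) -
              Real.log (1 - (χ (p : ZMod q)).re / p)) := by
          refine sum_congr rfl fun p _ => ?_
          simp only [hwdef, hadef, hbdef, one_div]; ring
        rw [heq]; exact h
      -- `|log L1 − F(X)| ≤ r(X)`
      have hF : |Real.log L1 - ∑ p ∈ Nat.primesLE X, b p| ≤ 2 * K' / Real.log ((X : ℝ) + 1) + 4 / ((X : ℝ) + 1) := by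
        have h := EulerProductOne.abs_log_sub_sum_le χ hχ1 hχsq hK' hX1
        rw [hnorm] at h
        exact h
      -- the algebra
      have hsum3 : ∑ p ∈ SX, (w p + a p + b p) = ∑ p ∈ SX, w p + ∑ p ∈ SX, a p + ∑ p ∈ SX, b p := by
        rw [sum_add_distrib, sum_add_distrib]
      have hsumP : ∑ p ∈ Nat.primesLE s₀, (a p + b p) = ∑ p ∈ Nat.primesLE s₀, a p + ∑ p ∈ Nat.primesLE s₀, b p :=
        sum_add_distrib
      have hlogτ : Real.log (gmRho d * (η * L)) = Real.log (gmRho d) + Real.log (η * L) :=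
        Real.log_mul hϱ.ne' hηL.ne'
      have hlogT : Real.log T = Real.log (η * L) + Real.log L1 := by
        rw [hTdef, Real.log_mul hηL.ne' hL1pos.ne']
      have hkey : Real.log (batemanHornPartial ![rabinowitschPoly d] X) - Real.log (gmRho d * (η * L)) =
          ∑ p ∈ SX, (w p + a p + b p) + (Real.log P₀ - Real.log T) +
            (Real.log L1 - ∑ p ∈ Nat.primesLE X, b p) := by
        rw [hlogB, hlogτ, hlogT, hlogP₀, hsum3, hsumP, hsa, hsb]
        simp only [hadef, hwdef]
        ring
      rw [hkey]
      calc |∑ p ∈ SX, (w p + a p + b p) + (Real.log P₀ - Real.log T) +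
            (Real.log L1 - ∑ p ∈ Nat.primesLE X, b p)|
          ≤ |∑ p ∈ SX, (w p + a p + b p)| + |Real.log P₀ - Real.log T| +
              |Real.log L1 - ∑ p ∈ Nat.primesLE X, b p| := abs_add_three _ _ _
        _ ≤ 16 / ((s₀ : ℝ) + 1) + δ + (2 * K' / Real.log ((X : ℝ) + 1) + 4 / ((X : ℝ) + 1)) :=
            add_le_add (add_le_add hkappa hmain) hF
        _ = Btot + (2 * K' / Real.log ((X : ℝ) + 1) + 4 / ((X : ℝ) + 1)) := by rw [hBtot]; ring
  /- ### Step 4: conclusion -/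
  obtain ⟨hc₀pos, hlogc⟩ := hlim
  have hcηL : 0 < c₀ / (η * L) := div_pos hc₀pos hηL
  have hB1 : Btot ≤ 1 := by linarith
  have hB2 : 2 * Btot ≤ ε := by linarith
  have h : |Real.log (gmRho d) - Real.log (c₀ / (η * L))| ≤ Btot := by
    rw [Real.log_div hc₀pos.ne' hηL.ne']
    rw [Real.log_mul hϱ.ne' hηL.ne'] at hlogc
    rw [abs_sub_comm] at hlogc
    have : Real.log (gmRho d) - (Real.log c₀ - Real.log (η * L)) =
        Real.log (gmRho d) + Real.log (η * L) - Real.log c₀ := by ring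
    rw [this]; exact hlogc
  exact abs_sub_le_mul_of_abs_log_sub_le hϱ hcηL hB1 hB2 h

/-- **The catalogued barrier, discharged modulo nothing but its two halves**: with Proposition 2
proved here, `SiegelZeroQuadraticPolynomials` follows from Theorem 4 alone
(`SiegelZeroQuadraticPolynomials_of_thm4`). [cite: GranvilleMollin2000, Theorem 4 and Proposition 2] -/
theorem SiegelZeroQuadraticPolynomials_of_thm4 (h4 : GranvilleMollin2000_thm4) :
    SiegelZeroQuadraticPolynomials :=
  ⟨h4, GranvilleMollin2000_prop2_holds⟩

end Literature.Barriers.Parity
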